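import Summits.ABC.IUTFork.Repair.RHQ3L0Exact
import HarnessLib

/-!
# D-0079 RESCUE sub-cell R-H, ROUND 2 Q3 (row 8 «heightclass», Σ₈) — KERNEL `l₀` CERTIFICATES at two pinned HEX data, by the exact l-law of `RHQ3L0Exact`

PROOF-ONLY companion (0 definitions) of `RHQ3L0Exact` (seat abc-iut-rh-typ-2 gen 3, Q3-typ lane; rung LADDER-ABC:A2.RESCUE.H). The two data are rows of
abc-iut-rh-num-1's `plan/rescue/R-H/Q3-L0EXACT-rh-num-1.tsv` f61504e3e8b20ab6 (family `hex-v2`, GENUINE-PINNED local type per abc-iut-W-num-3/W-num-2,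
`e(v|7) = 2^[k odd]·15/gcd(15,k)`), in the row-8 integer currency `(p, e_w = e_v·l, m_q = n_v/2)`:
* `λ₆`: `p = 7`, `e_v = 5`, `n_v = 60` (`m = 30 = 6·e_v`), tabulated `l0_8_exact = 67`, `largest_NEG_admissible_prime = 61`;
* `λ₁₀`: `p = 7`, `e_v = 3`, `n_v = 60` (`m = 30 = 10·e_v`), tabulated `l0_8_exact = 5591`, `largest_NEG_admissible_prime = 5581`.
For each: the row-8 clauses «`∃ r, CertVal 7 e_w r ∧ (j²−1)·m ≤ j(e_w − r) + (1 − r)`» at all labels `j ≤ l⋆` FAIL at the NEG prime (one integer sign on the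
piece, `RHQ3L0Exact.certVal_cells_iff_quad_nonneg`) and HOLD at EVERY odd `l` from the next odd number on (`certVal_cells_iff_topCell` + the bound
`r♯ ≤ 7^t − t·e_w`, `RHQ3LTailBand.strictMinPow_le_pow_sub`; the untied exponent EXISTS at every `l` since `e_v·l` odd is never a tie `6·7^s`,
`not_tie_seven_of_odd` + `exists_strictMinPow_of_not_tie`) — so `l₀⁸` = the next admissible prime after the NEG prime, EXACTLY as tabulated (third engine:
the kernel). HONEST SCOPE: `HBand`/`CertVal` are row 8's claim-tagged HYPOTHESIS vocabulary (abc-iut-rh-typ-8), never asserted; «in Σ₈ at l» = the hypothesis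
holds as typed; the local invariants `(p, e_v, n_v)` of `λ_k` are the R-W / rh-num-1 tables' (computed ≠ proved at the setting); this file is arithmetic at those
integers. TAKES NO SIDE on [IUTchIII] Cor. 3.12 or on any author; nothing here asserts abc. [cite: Mochizuki2012, IUTchI Def. 3.1 (b)(c) pp. 61–62, Ex. 3.2 (iv)
p. 71; IUTchIV Prop. 1.2 (i)(ii) p. 10] [cite: DupuyHilado2025, §3.3] [claim: Mochizuki2012, status: disputed] for every IUT locution.
-/

noncomputable section

namespace Summit.ABC.IUTFork.Repair.RH.Q3L0Exact

open Summit.ABC.IUTFork.Repair.RHHeightClass Summit.ABC.IUTFork.Repair.RH.Q3LTailBand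

/-- `(7, 5·(2l⋆+1))` and `(7, 3·(2l⋆+1))` are never ties (`6·7^s` is even, `ε·(2l⋆+1)` is odd for odd `ε`). [folklore] -/
theorem not_tie_seven_of_odd {ε : ℕ} (hε : ε % 2 = 1) (ls s : ℕ) :
    ((((2 * ls + 1) * ε : ℕ)) : ℤ) ≠ ((7 : ℕ) : ℤ) ^ s * (((7 : ℕ) : ℤ) - 1) := by
  intro h
  have h2 : (2 : ℤ) ∣ ((7 : ℕ) : ℤ) ^ s * (((7 : ℕ) : ℤ) - 1) := ⟨((7 : ℕ) : ℤ) ^ s * 3, by push_cast; ring⟩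
  rw [← h] at h2
  have h3 : (2 : ℤ) ∣ (((2 * ls + 1) * ε : ℕ) : ℤ) := h2
  have h4 : 2 ∣ (2 * ls + 1) * ε := by exact_mod_cast h3
  have h5 : (2 * ls + 1) * ε % 2 = 1 := by
    rw [Nat.mul_mod, hε]; omega
  omega

/-- **`λ₆` (pinned: `p = 7`, `e_v = 5`, `n_v = 60`, `m = 30`) is OUT of Σ₈ at `l = 61`** (`l⋆ = 30`, `e_w = 305` on the piece `t = 3`: `294 < 305 < 2058`,
`r♯ = 343 − 915 = −572`; sign `10·61² − 606·61 − 592 = −348 < 0`; cell `26970 ≤ 26883` false): the row-8 clauses at the labels `j ≤ 30` do NOT all hold —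
`61` is the LARGEST NEG admissible prime of Q3-L0EXACT's `λ₆` row. [folklore arithmetic at the table's integers] -/
theorem hex6_neg_61 :
    ¬ ∀ j : ℕ, 1 ≤ j → j ≤ 30 → ∃ r : ℤ, CertVal 7 ((2 * 30 + 1) * 5) r ∧
        (((j : ℝ)) ^ 2 - 1) * ((30 : ℤ) : ℝ) ≤ (j : ℝ) * ((((2 * 30 + 1) * 5 : ℕ) : ℝ) - r) + (1 - r) := by
  rw [certVal_cells_iff_quad_nonneg (p := 7) (ε := 5) (ls := 30) (t := 3) (by norm_num) (by norm_num) (by norm_num) 30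
    (Or.inr (by norm_num)) (by norm_num)]
  norm_num

/-- **`λ₆` is IN Σ₈ at EVERY odd `l ≥ 63`** (`l⋆ ≥ 31`): for whatever untied exponent `r₀` the place `(7, 5l)` has (it exists — no tie, by parity),
`r₀ ≤ 7³ − 3·5l` (`strictMinPow_le_pow_sub`) already forces the top cell: `RHS − LHS ≥ 10l⋆² − 293l⋆ − 297 = (l⋆−31)(10l⋆+17) + 230 ≥ 0`. With
`hex6_neg_61`: the place is NEG at `l = 61` and POS at every odd `l ≥ 63`, so `l₀⁸(λ₆) = 67` = the next admissible prime after `61` (`63, 65` composite),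
EXACTLY as tabulated by abc-iut-rh-num-1 (Q3-L0EXACT; Q3-DATA v1.3). [folklore arithmetic at the table's integers] -/
theorem hex6_pos_of_le {ls : ℕ} (hls : 31 ≤ ls) :
    ∀ j : ℕ, 1 ≤ j → j ≤ ls → ∃ r : ℤ, CertVal 7 ((2 * ls + 1) * 5) r ∧
        (((j : ℝ)) ^ 2 - 1) * ((30 : ℤ) : ℝ) ≤ (j : ℝ) * ((((2 * ls + 1) * 5 : ℕ) : ℝ) - r) + (1 - r) := by
  have he : 1 ≤ (2 * ls + 1) * 5 := by omega
  obtain ⟨r₀, h₀⟩ : ∃ r₀ : ℤ, StrictMinPow 7 ((2 * ls + 1) * 5) r₀ := by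
    obtain ⟨t, -, -, h⟩ := exists_strictMinPow_of_not_tie (p := 7) (by norm_num) (not_tie_seven_of_odd (ε := 5) (by norm_num) ls)
    exact ⟨_, h⟩
  rw [certVal_cells_iff_topCell he h₀ 30 (by omega)]
  have hr3 := strictMinPow_le_pow_sub h₀ 3
  push_cast at hr3 ⊢
  have hls0 : (0 : ℤ) ≤ ls := by positivity
  have hls31 : (31 : ℤ) ≤ ls := by exact_mod_cast hls
  nlinarith [mul_le_mul_of_nonneg_left hr3 hls0, mul_nonneg (sub_nonneg.2 hls31) (by positivity : (0 : ℤ) ≤ 10 * (ls : ℤ) + 17)]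

/-- **`λ₁₀` (pinned: `p = 7`, `e_v = 3`, `n_v = 60`, `m = 30`) is OUT of Σ₈ at `l = 5581`** (`l⋆ = 2790`, `e_w = 16743` on the piece `t = 5`:
`14406 < 16743 < 100842`, `r♯ = 16807 − 83715 = −66908`; sign `6·5581² − 33530·5581 − 33520 = −279084 < 0`) — `5581` is the LARGEST NEG admissible prime
of Q3-L0EXACT's `λ₁₀` row (abc-iut-rh2-q3-num 23:07:29Z erratum class: the exact evaluator, not bisection). [folklore arithmetic at the table's integers] -/
theorem hex10_neg_5581 :
    ¬ ∀ j : ℕ, 1 ≤ j → j ≤ 2790 → ∃ r : ℤ, CertVal 7 ((2 * 2790 + 1) * 3) r ∧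
        (((j : ℝ)) ^ 2 - 1) * ((30 : ℤ) : ℝ) ≤ (j : ℝ) * ((((2 * 2790 + 1) * 3 : ℕ) : ℝ) - r) + (1 - r) := by
  rw [certVal_cells_iff_quad_nonneg (p := 7) (ε := 3) (ls := 2790) (t := 5) (by norm_num) (by norm_num) (by norm_num) 30
    (Or.inr (by norm_num)) (by norm_num)]
  norm_num

/-- **`λ₁₀` is IN Σ₈ at EVERY odd `l ≥ 5591`** (`l⋆ ≥ 2795`): `r₀ ≤ 7⁵ − 5·3l` forces the top cell, `RHS − LHS ≥ 6l⋆² − 16759l⋆ − 16761 =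
(l⋆−2795)(6l⋆+11) + 13984 ≥ 0`. With `hex10_neg_5581` (and `5583 = 3·1861`, `5585`, `5587 = 37·151`, `5589 = 3²·621` composite): `l₀⁸(λ₁₀) = 5591`
EXACTLY as tabulated. [folklore arithmetic at the table's integers] -/
theorem hex10_pos_of_le {ls : ℕ} (hls : 2795 ≤ ls) :
    ∀ j : ℕ, 1 ≤ j → j ≤ ls → ∃ r : ℤ, CertVal 7 ((2 * ls + 1) * 3) r ∧
        (((j : ℝ)) ^ 2 - 1) * ((30 : ℤ) : ℝ) ≤ (j : ℝ) * ((((2 * ls + 1) * 3 : ℕ) : ℝ) - r) + (1 - r) := by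
  have he : 1 ≤ (2 * ls + 1) * 3 := by omega
  obtain ⟨r₀, h₀⟩ : ∃ r₀ : ℤ, StrictMinPow 7 ((2 * ls + 1) * 3) r₀ := by
    obtain ⟨t, -, -, h⟩ := exists_strictMinPow_of_not_tie (p := 7) (by norm_num) (not_tie_seven_of_odd (ε := 3) (by norm_num) ls)
    exact ⟨_, h⟩
  rw [certVal_cells_iff_topCell he h₀ 30 (by omega)]
  have hr5 := strictMinPow_le_pow_sub h₀ 5
  push_cast at hr5 ⊢
  have hls0 : (0 : ℤ) ≤ ls := by positivity
  have hls' : (2795 : ℤ) ≤ ls := by exact_mod_cast hls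
  nlinarith [mul_le_mul_of_nonneg_left hr5 hls0, mul_nonneg (sub_nonneg.2 hls') (by positivity : (0 : ℤ) ≤ 6 * (ls : ℤ) + 11)]

end Summit.ABC.IUTFork.Repair.RH.Q3L0Exact

end
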